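import Summits.BirchSwinnertonDyer.BirchSwinnertonDyer.Theorems.ThetaPartnerAtTwoSignedControlAtTwoPlusCoinvOfHonda
import Summits.BirchSwinnertonDyer.BirchSwinnertonDyer.Theorems.ThetaPartnerAtTwoSignedControlAtTwoPlusHondaTransportNonDiv
import Summits.BirchSwinnertonDyer.BirchSwinnertonDyer.Theorems.ThetaPartnerAtTwoSignedControlAtTwoStubPlusHondaSystemTwo
import HarnessLib

/-!
# Road T for item 23110, the module-level core of (R3) = (T2)⁺: the TWISTED `Γ`-coinvariants of `(⋃ₙ E⁺(K_n·K_v)) ⊗ ℚ_p/ℤ_p`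
# vanish — `E⁺_∞ ⊗ ℚ_p/ℤ_p` is `(u·g − 1)`-divisible for every `u ≡ 1 (mod p)` — from the plus Honda system; at `p = 2`
# UNCONDITIONALLY for `GoodSS`, `a₂ = 0` (HONDA⁺@2 is a tree theorem)

Route `ResidualThetaTransportAtTwo` (RTT, crux r201 `ResidualLambdaFormulaNegDiscAtTwo`, stmt-BirchSwinnertonDyer-23110) /
`ThetaPartnerAtTwo` (TP2). Seat `prover-bsd-wall-tp2-p2x-w3` g12; `--supports stmt-BirchSwinnertonDyer-23110`. THEOREMS ONLY (no
definition, no named fact, no `sorry`); route-independent; closes nothing.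

WHY (lead memo RLF-TWIST-ROAD-g12 §3 (R3)): the twisted local descent (T2)⁺ at the place above `2` — «every local class `c` with
`ψ_u c = u·conj_g c − c` in the `+` Kummer condition lifts to `H¹(ℚ₂, E[2^J](χ_u))` modulo `+`» — needs, at module level,
`((E⁺_∞ ⊗ ℚ₂/ℤ₂)(χ_u))_Γ = 0`, the twisted form of the input (DIV⁺@2) of the LOC⁺ engine
`SignedEC.exists_localLift_kummer_of_coinvariantsDiv` (K4, `…PlusLocEngine`). K4 proved the UNTWISTED statement from the plus Honda
system (`SignedEC.plusLocOne_of_honda` ⟹ `plusDiv_of_honda` ⟹ `plusCoinvPair_of_honda`, `…PlusCoinvOfHonda`). THIS FILE observes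
that the twist costs nothing at module level BECAUSE `u ≡ 1 (mod p)`: `u·g y − y = (g y − y) + (u−1)·g y` and `(u−1)·g y ∈ p·E⁺`,
so LOC1⁺ `x = (g y − y) + p z` rewrites as `x = (u·g y − y) + p z'`, and the iteration of K4 runs verbatim with `u·g` for `g`:

* `plusDivTwisted_of_honda` — any `K`, `p`, `κ`, `ι`, Honda package, (NT), (IDX), local `g` restricting to the topological generator,
  `u ≡ 1 (mod p)`: every `x ∈ E⁺(K_{2j}·K_v)` is `(u·g y − y) + p^k z` with `y, z ∈ E⁺(K_{2j+2k}·K_v)`, every `k`;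
* `plusCoinvariantsDivTwisted_of_honda` — the engine shape: for `x ∈ A = ⋃ₙ E⁺_n` and `k` there are `y, w ∈ A` with
  `p^k x − p^k (u·g y − y) = p^{k+k} w`, i.e. `((⋃E⁺_n) ⊗ ℚ_p/ℤ_p)(χ_u)_Γ = 0`;
* `plusCoinvariantsDivTwisted_two` — `K = ℚ`, `p = 2`, `W` globally minimal with `GoodSS W 2` and `a₂ = 0`, cyclotomic `κ`, `v ∋ 2`,
  `u` odd: UNCONDITIONAL, the Honda system being the tree theorem `PlusLayer.plusHondaSystemTwo_padic` (HONDA⁺@2) transported by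
  `plusHondaSystem_adicCompletion_of_padic_nonDiv`, (NT)/(IDX) by `SSFlatEC.eq_zero_of_mem_localTowerPointsOfEmb_of_two_nsmul` /
  `index_subgroupOf_localLayerSubgroupOfEmb_succ_eq` — the `u`-twist of K4's `plusCoinvPair_two_of_honda` (`u = 1`).

What (R3) still needs on top (not here): the twisted `cd_p ℤ_p = 1` + Kummer plumbing — the `χ_u`-twin of
`SignedEC.exists_localLift_kummer_of_coinvariantsDiv` / `…PlusLocShift` with values in `H¹(ℚ₂, E[2^J](χ_u))`, as in
`…RlfTwistedLocalDescentAwayP` (this seat) at `v ∤ p`. HONEST FRAMING: closes nothing; 23110 is NOT proved; BSD is not proved by any of this.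
References: [Kobayashi2003] §8.4 (Lemma 8.9, Prop. 8.11, Prop. 8.12), Thm. 6.2, Prop. 8.23; [BDKim2013] Props. 2.2–2.3, proof of Cor. 3.15;
[GreenbergLNM1716] §4 pp. 107–108, 124; [Sprung2012] Thm. 2.2.
-/

set_option autoImplicit false
-- the Theorems namespace of this sub repeats the summit name by design (D-0017 nested layout)
set_option linter.dupNamespace false

noncomputable section

open scoped Classical NumberField

namespace Summit.BirchSwinnertonDyer.BirchSwinnertonDyer.Theorems.SignedEC.TwistedLocalDescent

open Literature.NumberTheory.EllipticCurves Literature.NumberTheory.GaloisRepresentations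
  WeierstrassCurve ZpExtension Literature.NumberTheory.EllipticCurves.Kobayashi2003
  Literature.NumberTheory.EllipticCurves.Sprung2012 Summit.BirchSwinnertonDyer.Rank1Residual.Additive

universe u

section General

variable {K : Type u} [Field K] (W : WeierstrassCurve K) {p : ℕ} [Fact p.Prime] (κ : ZpExtension K p)
  {E : Type u} [Field E] [Algebra K E] (ι : AlgebraicClosure K →ₐ[K] AlgebraicClosure E)

/-- **DIV⁺ twisted by `χ_u`**: under the plus Honda package (with (NT), (IDX), `g` a local lift of the topological generator) and for
`u ≡ 1 (mod p)`, every `x ∈ E⁺(K_{2j}·K_v)` is `(u·g y − y) + p^k z` with `y, z ∈ E⁺(K_{2j+2k}·K_v)`, for every `k`. Iterate K4's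
LOC1⁺ (`plusLocOne_of_honda`), rewriting `g y' − y' = (u·g y' − y') − (u−1)·g y'` and absorbing `(u−1)·g y' = p·(c·g y')` into the
`p`-multiple. [cite: Kobayashi2003, Prop. 8.12, Thm. 6.2] [cite: GreenbergLNM1716, §4 p. 107] -/
theorem plusDivTwisted_of_honda
    (hnt : ∀ P ∈ localTowerPointsOfEmb κ ι W, p • P = 0 → P = 0)
    (hidx : ∀ m : ℕ, ((localLayerSubgroupOfEmb κ ι (m + 1)).subgroupOf (localLayerSubgroupOfEmb κ ι m)).index = p)
    {g : Field.absoluteGaloisGroup E} (hg : κ.IsTopGenerator (resGalOfEmb ι g))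
    (d : ℕ → localPoints W E) (hd : ∀ m, d m ∈ localLayerPointsOfEmb κ ι W m)
    (htr : ∀ m, localTraceOfEmb κ ι W (m + 1) (m + 2) (d (m + 2)) = -d m)
    (hgen : ∀ m : ℕ, 1 ≤ m → ∀ P ∈ localLayerPointsOfEmb κ ι W m,
      ∃ B ∈ AddSubgroup.closure (Set.range fun σ : Field.absoluteGaloisGroup E ↦ σ • d m),
        ∃ P' ∈ localLayerPointsOfEmb κ ι W (m - 1), ∃ R ∈ localLayerPointsOfEmb κ ι W m, P = B + P' + p • R)
    (hgen0 : ∀ P ∈ localLayerPointsOfEmb κ ι W 0, ∃ a : ℤ, ∃ R ∈ localLayerPointsOfEmb κ ι W 0, P = a • d 0 + p • R)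
    {u : ℤ} (hu : (p : ℤ) ∣ u - 1) :
    ∀ k j : ℕ, ∀ x ∈ signedLocalPointsOfEmb κ ι W 1 (2 * j),
      ∃ y ∈ signedLocalPointsOfEmb κ ι W 1 (2 * j + 2 * k), ∃ z ∈ signedLocalPointsOfEmb κ ι W 1 (2 * j + 2 * k),
        x = (u • g • y - y) + p ^ k • z := by
  obtain ⟨c, hc⟩ := hu
  have hu' : u = p * c + 1 := by linear_combination hc
  have hstab : ∀ (n : ℕ) (σ : Field.absoluteGaloisGroup E), ∀ a ∈ signedLocalPointsOfEmb κ ι W 1 n,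
      σ • a ∈ signedLocalPointsOfEmb κ ι W 1 n := by
    intro n σ a ha
    rw [signedLocalPointsOfEmb_eq_towerSigned] at ha ⊢
    exact smul_mem_towerSignedLocalPointsOfEmb κ.layerSubgroup ι W 1 n σ ha
  have galois_smul_zsmul : ∀ (τ : Field.absoluteGaloisGroup E) (n : ℤ) (P : localPoints W E), τ • (n • P) = n • (τ • P) :=
    fun τ n P ↦ map_zsmul (DistribSMul.toAddMonoidHom (localPoints W E) τ) n P
  intro k
  induction k with
  | zero =>
    intro j x hx
    refine ⟨0, AddSubgroup.zero_mem _, x, by simpa using hx, ?_⟩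
    rw [smul_zero, smul_zero, sub_zero, zero_add, pow_zero, one_smul]
  | succ k ih =>
    intro j x hx
    obtain ⟨y, hy, z, hz, hxe⟩ := ih j x hx
    have hz' : z ∈ signedLocalPointsOfEmb κ ι W 1 (2 * (j + k)) := by rwa [show 2 * (j + k) = 2 * j + 2 * k by ring]
    obtain ⟨y', hy', z', hz', hze⟩ := plusLocOne_of_honda W κ ι hnt hidx hg d hd htr hgen hgen0 (j + k) z hz'
    have hlay : 2 * (j + k) + 2 = 2 * j + 2 * (k + 1) := by ring
    rw [hlay] at hy' hz'
    have hmono : signedLocalPointsOfEmb κ ι W 1 (2 * j + 2 * k) ≤ signedLocalPointsOfEmb κ ι W 1 (2 * j + 2 * (k + 1)) :=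
      signedLocalPointsOfEmb_mono κ ι W 1 (by omega)
    refine ⟨y + p ^ k • y', add_mem (hmono hy) (AddSubgroup.nsmul_mem _ hy' _),
      z' - c • g • y', sub_mem hz' (AddSubgroup.zsmul_mem _ (hstab _ g y' hy') c), ?_⟩
    -- `z = (g y' − y') + p z' = (u g y' − y') + p (z' − c g y')`
    have hze' : z = (u • g • y' - y') + p • (z' - c • g • y') := by
      rw [hze, hu', add_smul, one_smul, mul_smul, natCast_zsmul, smul_sub (p : ℕ), smul_comm (p : ℕ) c (g • y')]
      abel
    rw [hxe, hze']
    rw [smul_add (g : Field.absoluteGaloisGroup E), galois_smul_nsmul_modP W g, smul_add u, smul_comm u (p ^ k) (g • y'),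
      pow_succ, mul_smul, smul_add (p ^ k), smul_sub (p ^ k)]
    abel

/-- **`((⋃ₙ E⁺_n) ⊗ ℚ_p/ℤ_p)(χ_u)_Γ = 0` in the engine shape** (the `χ_u`-twin of the hypothesis `hdiv` of
`SignedEC.exists_localLift_kummer_of_coinvariantsDiv`, with `j = k`): under the plus Honda package, for every `u ≡ 1 (mod p)`, every
`x ∈ A = ⋃ₙ E⁺(K_n·K_v)` and every `k` there are `y, w ∈ A` with `p^k·x − p^k·(u·g y − y) = p^{k+k}·w`.
[cite: Kobayashi2003, Thm. 6.2, Prop. 8.23] [cite: BDKim2013, Props. 2.2–2.3] [cite: GreenbergLNM1716, §4 pp. 107–108] -/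
theorem plusCoinvariantsDivTwisted_of_honda
    (hnt : ∀ P ∈ localTowerPointsOfEmb κ ι W, p • P = 0 → P = 0)
    (hidx : ∀ m : ℕ, ((localLayerSubgroupOfEmb κ ι (m + 1)).subgroupOf (localLayerSubgroupOfEmb κ ι m)).index = p)
    {g : Field.absoluteGaloisGroup E} (hg : κ.IsTopGenerator (resGalOfEmb ι g))
    (d : ℕ → localPoints W E) (hd : ∀ m, d m ∈ localLayerPointsOfEmb κ ι W m)
    (htr : ∀ m, localTraceOfEmb κ ι W (m + 1) (m + 2) (d (m + 2)) = -d m)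
    (hgen : ∀ m : ℕ, 1 ≤ m → ∀ P ∈ localLayerPointsOfEmb κ ι W m,
      ∃ B ∈ AddSubgroup.closure (Set.range fun σ : Field.absoluteGaloisGroup E ↦ σ • d m),
        ∃ P' ∈ localLayerPointsOfEmb κ ι W (m - 1), ∃ R ∈ localLayerPointsOfEmb κ ι W m, P = B + P' + p • R)
    (hgen0 : ∀ P ∈ localLayerPointsOfEmb κ ι W 0, ∃ a : ℤ, ∃ R ∈ localLayerPointsOfEmb κ ι W 0, P = a • d 0 + p • R)
    {u : ℤ} (hu : (p : ℤ) ∣ u - 1) :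
    ∀ x ∈ (⨆ n, signedLocalPointsOfEmb κ ι W 1 n), ∀ k : ℕ,
      ∃ y ∈ (⨆ n, signedLocalPointsOfEmb κ ι W 1 n), ∃ w ∈ (⨆ n, signedLocalPointsOfEmb κ ι W 1 n),
        p ^ k • x - p ^ k • (u • g • y - y) = p ^ (k + k) • w := by
  intro x hx k
  obtain ⟨n, hxn⟩ := (AddSubgroup.mem_iSup_of_directed (signedLocalPointsOfEmb_mono κ ι W 1).directed_le).1 hx
  have hx2n : x ∈ signedLocalPointsOfEmb κ ι W 1 (2 * n) := signedLocalPointsOfEmb_mono κ ι W 1 (by omega) hxn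
  obtain ⟨y, hy, z, hz, hxe⟩ := plusDivTwisted_of_honda W κ ι hnt hidx hg d hd htr hgen hgen0 hu k n x hx2n
  have hle : signedLocalPointsOfEmb κ ι W 1 (2 * n + 2 * k) ≤ ⨆ m, signedLocalPointsOfEmb κ ι W 1 m :=
    le_iSup (fun m ↦ signedLocalPointsOfEmb κ ι W 1 m) (2 * n + 2 * k)
  refine ⟨y, hle hy, z, hle hz, ?_⟩
  rw [hxe, pow_add, mul_smul, smul_add (p ^ k)]
  abel

end General

/-! ## `K = ℚ`, `p = 2`: the twisted coinvariants vanish UNCONDITIONALLY for `GoodSS`, `a₂ = 0` -/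

section Two

open NumberField IsDedekindDomain

variable (W : WeierstrassCurve ℚ) [W.IsElliptic] [W.IsGloballyMinimal]

/-- **`((⋃ₙ E⁺(ℚ_{2,n})) ⊗ ℚ₂/ℤ₂)(χ_u)_Γ = 0`, unconditionally.** For `W/ℚ` globally minimal with good supersingular reduction at `2` and
`a₂(W) = 0`, the cyclotomic `ℤ₂`-extension `κ`, the place `v ∋ 2`, a local `g ∈ Γ_{ℚ_v}` restricting to a topological generator of
`Gal(ℚ_∞/ℚ)`, and every odd `u`: for every `x ∈ A = ⋃ₙ E⁺(ℚ_{2,n})` and `k` there are `y, w ∈ A` with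
`2^k·x − 2^k·(u·g y − y) = 2^{k+k}·w`. The plus Honda system is the tree theorem HONDA⁺@2 (`PlusLayer.plusHondaSystemTwo_padic`
transported by `plusHondaSystem_adicCompletion_of_padic_nonDiv`); (NT), (IDX) as in `plusCoinvPair_two_of_honda`.
[cite: Kobayashi2003, Thm. 6.2, Prop. 8.23, §8.4] [cite: BDKim2013, Props. 2.2–2.3] [cite: Sprung2012, Thm. 2.2] -/
theorem plusCoinvariantsDivTwisted_two (hss : Rank1Residual.GoodSS W 2) (ha : W.frobeniusTrace 2 = 0) {κ : ZpExtension ℚ 2}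
    (hκ : κ.IsCyclotomic) (v : HeightOneSpectrum (𝓞 ℚ)) (hv : (2 : 𝓞 ℚ) ∈ v.asIdeal)
    {g : Field.absoluteGaloisGroup (v.adicCompletion ℚ)}
    (hg : κ.IsTopGenerator (resGalOfEmb (closureEmb (K := ℚ) (v.adicCompletion ℚ)) g)) {u : ℤ} (hu : (2 : ℤ) ∣ u - 1) :
    ∀ x ∈ (⨆ n, signedLocalPoints κ (v.adicCompletion ℚ) W 1 n), ∀ k : ℕ,
      ∃ y ∈ (⨆ n, signedLocalPoints κ (v.adicCompletion ℚ) W 1 n),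
        ∃ w ∈ (⨆ n, signedLocalPoints κ (v.adicCompletion ℚ) W 1 n),
          2 ^ k • x - 2 ^ k • (u • g • y - y) = 2 ^ (k + k) • w := by
  have hnt : ∀ P ∈ localTowerPointsOfEmb κ (closureEmb (K := ℚ) (v.adicCompletion ℚ)) W, 2 • P = 0 → P = 0 :=
    fun P hP h2 ↦ SSFlatEC.eq_zero_of_mem_localTowerPointsOfEmb_of_two_nsmul W hss κ (by exact_mod_cast hv) _ hP h2
  have hidx := index_subgroupOf_localLayerSubgroupOfEmb_succ_eq (p := 2) hκ v (by exact_mod_cast hv)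
  obtain ⟨d, hd, htr, hgen, hgen0⟩ := plusHondaSystem_adicCompletion_of_padic_nonDiv W hss κ v hv
    fun ι ↦ PlusLayer.plusHondaSystemTwo_padic W hss ha κ hκ ι
  exact plusCoinvariantsDivTwisted_of_honda W κ (closureEmb (K := ℚ) (v.adicCompletion ℚ)) hnt hidx hg d hd htr hgen hgen0
    (by exact_mod_cast hu)

end Two

end Summit.BirchSwinnertonDyer.BirchSwinnertonDyer.Theorems.SignedEC.TwistedLocalDescent

end
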